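import Mathlib
import HarnessLib

/-!
# Kashiwara–Vergne (1978), Ch. III: the parameters `Σ`, `τ(λ)` and `τ(λ) ⊗ δ_k` of the
# decomposition of the `k`-fold harmonic (oscillator) representation of `U(p,q)` under `U(k)`

Reproduction (typed, kernel-checked combinatorial part) of: M. Kashiwara, M. Vergne, *On the
Segal–Shale–Weil representations and harmonic polynomials*, Invent. Math. **44** (1978) 1–47,
Chapter III "Tensor products of the harmonic representation of `U(p,q)`", Theorem (6.3) p. 44 and
Theorem (7.2) p. 45 (with (2.1) p. 34 and Proposition (4.1) p. 39 for `λ′` and `δ_k`)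
[KashiwaraVergne1978].  The source was read on the page images of the GDZ digitisation
(PPN356556735_0044); every quotation below was checked on the image (the OCR layer drops displays).

What is reproduced.  KV decompose the `k`-th tensor power `L_k` of the harmonic representation of
`G = U(p,q)` under the commuting action of `U(k)`: `L_k = ⊕_{λ ∈ Σ} (dim V_λ) L_k(λ)` (Thm (7.2) 1)),
where `L_k(λ)` is "an irreducible unitary representation of `G` of highest weight `τ(λ) ⊗ δ_k`"
(Thm (7.2) 2)), and Thm (6.3) describes `Σ ⊂ U(k)^` and `τ(λ)` EXPLICITLY in terms of integer highest
weights (upper-triangular Borel subalgebras `𝔟_k`, `𝔟_p⁺ × 𝔟_q⁺`, §6 pp. 43–44), verbatim: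

"(6.3) Theorem. a) `Σ = {λ = (n₁, …, n_i, 0, …, 0, −m₁, −m₂, …, −m_j)  n₁ ≥ ⋯ ≥ n_i > 0,
0 < m₁ ≤ m₂ ≤ ⋯ ≤ m_j, 0 ≤ i ≤ q, 0 ≤ j ≤ p, i + j ≤ k`.  b) If `λ ∈ Σ`, the representation `τ(λ)` is
`τ₁(0, 0, …, 0, −m₁, −m₂, …, −m_j) ⊗ τ₂(n₁, …, n_i, 0, …, 0)`.  c) For any `k`, the map `λ ↦ τ(λ)` is
injective."  and (4.1) p. 39: "Here `δ_k(g₁, g₂) = (det g₂)^k` for `g₁ ∈ GL(p, ℂ)`, `g₂ ∈ GL(q, ℂ)`."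

This file contains ONLY the combinatorics of these parameters, as real definitions on integer
vectors, in the style of `Literature.RepresentationTheory.Semisimple.LimitOfDiscreteSeriesData`
(no analysis, no representations):

* `kvLambda i j n m : Fin k → ℤ` — the weight `(n₁,…,n_i,0,…,0,−m₁,…,−m_j)` of (6.3 a);
  `kvDual` — `λ′ = (−λ_k, …, −λ₁)`, the highest weight of the contragredient ((2.1) p. 34);
* `kvTau1 j m : Fin p → ℤ`, `kvTau2 i n : Fin q → ℤ` — the two factors of `τ(λ)` in (6.3 b);
* `KVParam k p q` — the parameter set of (6.3 a) (`i ≤ q`, `j ≤ p`, `i + j ≤ k`, `n` antitone and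
  positive, `m` monotone and positive), with `P.lam = λ`, `P.tau = τ(λ)` and
  `P.lowest = τ(λ) ⊗ δ_k` (the second factor shifted by `k`: the highest weight of `L_k(λ)`,
  Thm (7.2) 2));
* PROVED: `KVParam.lam_eq_of_tau_eq` — (6.3 c) for the explicit parametrisation: `τ(λ)`
  determines `λ` (so, on this parameter set, (c) is a COMPUTATION, independent of the cited
  proof); `KVParam.lam_eq_of_lowest_eq` — so does `τ(λ) ⊗ δ_k`; `KVParam.exists_one_two_one` — the
  worked line `(k; p, q) = (1; 2, 1)`: every `λ = (t)`, `t ∈ ℤ`, is a parameter, with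
  `τ(λ) ⊗ δ₁ = (0, min(t,0)) ⊗ (max(t,0) + 1)`.

NOT here: the spaces `ℒ_k`, `ℒ(λ)`, the representations `L_k(λ)`, `T(τ ⊗ δ_k)`, pluriharmonic
polynomials, or Theorems (6.3)/(7.2) AS STATEMENTS ABOUT REPRESENTATIONS (these need the oscillator
representation of `U(p,q)`, absent from Mathlib and the tree); nor the standing hypothesis `q ≤ p`
of KV Ch. III ((1.1) p. 31: `p = q + r`), which the parametrisation does not use.

## Mathlib / tree search

Mathlib has weights of Lie modules (`LieModule.Weight`) but no `U(p,q)`, no oscillator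
representation, no theta correspondence; `lean search --decl 'Kashiwara|harmonicRep|thetaCorr'`:
no Literature hits (2026-08-18).  Related tree file (same style):
`Literature/RepresentationTheory/Semisimple/LimitOfDiscreteSeriesData.lean`; the tree's `U(p,q)`
discrete-series parameters are `Literature.NumberTheory.Automorphic.LDSDatum`.

## References

* M. Kashiwara, M. Vergne, Invent. Math. 44 (1978) 1–47, Ch. III: (2.1) p. 34, (4.1) p. 39,
  §6 pp. 43–44, Thm (6.3) p. 44, (7.1)–(7.2) pp. 44–45, (8.1) p. 45. [KashiwaraVergne1978]
-/

namespace Literature.RepresentationTheory.KashiwaraVergne1978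

/-! ## The weights of Theorem (6.3) -/

/-- `λ′`, "the contragredient representation of `λ`" as a `𝔟_k`-highest weight:
`λ′ = (−λ_k, …, −λ₁)` (for `λ = (λ₁, …, λ_k)` dominant, the highest weight of the dual is the
negative of the lowest weight). [cite: KashiwaraVergne1978, III (2.1) p. 34] -/
def kvDual {k : ℕ} (lam : Fin k → ℤ) : Fin k → ℤ := fun ν => -lam (Fin.rev ν)

/-- `kvDual` is an involution. [cite: KashiwaraVergne1978, III (2.1) p. 34] -/
theorem kvDual_kvDual {k : ℕ} (lam : Fin k → ℤ) : kvDual (kvDual lam) = lam := by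
  funext ν
  simp [kvDual, Fin.rev_rev]

/-- The weight `λ = (n₁, …, n_i, 0, …, 0, −m₁, −m₂, …, −m_j) ∈ U(k)^` of Theorem (6.3 a)
(`i + j ≤ k`; entries `ν < i` are `n_ν`, the last `j` entries are `−m₁, …, −m_j`, the rest `0`).
[cite: KashiwaraVergne1978, III Thm (6.3) a) p. 44] -/
def kvLambda {k : ℕ} (i j : ℕ) (hij : i + j ≤ k) (n : Fin i → ℤ) (m : Fin j → ℤ) :
    Fin k → ℤ := fun ν =>
  if h : ν.val < i then n ⟨ν.val, h⟩
  else if h' : k - j ≤ ν.val then -(m ⟨ν.val - (k - j), by omega⟩) else 0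

/-- `τ₁(0, 0, …, 0, −m₁, −m₂, …, −m_j)`, a `𝔟_p⁺`-highest weight of `GL(p, ℂ)` (`j ≤ p`), the first
factor of `τ(λ)` in Theorem (6.3 b). [cite: KashiwaraVergne1978, III Thm (6.3) b) p. 44] -/
def kvTau1 {p : ℕ} (j : ℕ) (hj : j ≤ p) (m : Fin j → ℤ) : Fin p → ℤ := fun a =>
  if h : p - j ≤ a.val then -(m ⟨a.val - (p - j), by omega⟩) else 0

/-- `τ₂(n₁, …, n_i, 0, …, 0)`, a `𝔟_q⁺`-highest weight of `GL(q, ℂ)` (`i ≤ q`), the second factor of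
`τ(λ)` in Theorem (6.3 b). [cite: KashiwaraVergne1978, III Thm (6.3) b) p. 44] -/
def kvTau2 {q : ℕ} (i : ℕ) (_hi : i ≤ q) (n : Fin i → ℤ) : Fin q → ℤ := fun b =>
  if h : b.val < i then n ⟨b.val, h⟩ else 0

/-- The parameter set of Theorem (6.3 a), verbatim: "`n₁ ≥ ⋯ ≥ n_i > 0`, `0 < m₁ ≤ m₂ ≤ ⋯ ≤ m_j`,
`0 ≤ i ≤ q`, `0 ≤ j ≤ p`, `i + j ≤ k`" — so that `Σ = {kvLambda P.i P.j P.hij P.n P.m}`.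
[cite: KashiwaraVergne1978, III Thm (6.3) a) p. 44] -/
structure KVParam (k p q : ℕ) where
  /-- number of positive entries of `λ` -/
  i : ℕ
  /-- number of negative entries of `λ` -/
  j : ℕ
  /-- `0 ≤ i ≤ q` -/
  hi : i ≤ q
  /-- `0 ≤ j ≤ p` -/
  hj : j ≤ p
  /-- `i + j ≤ k` -/
  hij : i + j ≤ k
  /-- `n₁ ≥ ⋯ ≥ n_i > 0` -/
  n : Fin i → ℤ
  /-- `0 < m₁ ≤ ⋯ ≤ m_j` -/
  m : Fin j → ℤ
  /-- `n` is non-increasing -/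
  n_anti : Antitone n
  /-- `m` is non-decreasing -/
  m_mono : Monotone m
  /-- `n_ν > 0` -/
  n_pos : ∀ a, 0 < n a
  /-- `m_ν > 0` -/
  m_pos : ∀ b, 0 < m b

namespace KVParam

variable {k p q : ℕ} (P : KVParam k p q)

/-- `λ(P) = (n₁, …, n_i, 0, …, 0, −m₁, …, −m_j)`, the element of `Σ` with parameter `P`.
[cite: KashiwaraVergne1978, III Thm (6.3) a) p. 44] -/
def lam : Fin k → ℤ := kvLambda P.i P.j P.hij P.n P.m

/-- `τ(λ(P)) = τ₁(0,…,0,−m₁,…,−m_j) ⊗ τ₂(n₁,…,n_i,0,…,0)`, as the pair of its integer highest weights.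
[cite: KashiwaraVergne1978, III Thm (6.3) b) p. 44] -/
def tau : (Fin p → ℤ) × (Fin q → ℤ) := (kvTau1 P.j P.hj P.m, kvTau2 P.i P.hi P.n)

/-- `τ(λ(P)) ⊗ δ_k` with "`δ_k(g₁, g₂) = (det g₂)^k` for `g₁ ∈ GL(p, ℂ)`, `g₂ ∈ GL(q, ℂ)`" — the
highest weight of the irreducible unitary representation `L_k(λ)` ("`L_k(λ)` is an irreducible
unitary representation of `G` of highest weight `τ(λ) ⊗ δ_k`"): `δ_k` adds `k` to every entry of
the second factor. [cite: KashiwaraVergne1978, III Prop (4.1) p. 39 and Thm (7.2) 2) p. 45] -/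
def lowest : (Fin p → ℤ) × (Fin q → ℤ) :=
  (kvTau1 P.j P.hj P.m, fun b => kvTau2 P.i P.hi P.n b + k)

/-- `τ(λ) ⊗ δ_k` determines `τ(λ)` (`δ_k` only shifts the second factor).
[cite: KashiwaraVergne1978, III Prop (4.1) p. 39] -/
theorem tau_eq_of_lowest_eq {P P' : KVParam k p q} (e : P.lowest = P'.lowest) :
    P.tau = P'.tau := by
  have e1 := congrArg Prod.fst e
  have e2 := congrArg Prod.snd e
  simp only [lowest] at e1 e2
  refine Prod.ext e1 ?_
  funext b
  have hb := congrFun e2 b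
  simp only [add_left_inj] at hb
  simpa [tau] using hb

/-- The number `i` of positive entries of `λ` is read off `τ₂(λ)`.
[cite: KashiwaraVergne1978, III Thm (6.3) b)–c) p. 44] -/
theorem i_eq_of_tau2_eq {P P' : KVParam k p q}
    (e : kvTau2 P.i P.hi P.n = kvTau2 P'.i P'.hi P'.n) : P.i = P'.i := by
  by_contra hne
  rcases Nat.lt_or_gt_of_ne hne with h | h
  · have hb : P.i < q := lt_of_lt_of_le h P'.hi
    have t := congrFun e ⟨P.i, hb⟩
    simp only [kvTau2, lt_irrefl, dif_neg, not_false_eq_true, dif_pos h] at t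
    have := P'.n_pos ⟨P.i, h⟩
    omega
  · have hb : P'.i < q := lt_of_lt_of_le h P.hi
    have t := congrFun e ⟨P'.i, hb⟩
    simp only [kvTau2, lt_irrefl, dif_neg, not_false_eq_true, dif_pos h] at t
    have := P.n_pos ⟨P'.i, h⟩
    omega

/-- The number `j` of negative entries of `λ` is read off `τ₁(λ)`.
[cite: KashiwaraVergne1978, III Thm (6.3) b)–c) p. 44] -/
theorem j_eq_of_tau1_eq {P P' : KVParam k p q}
    (e : kvTau1 P.j P.hj P.m = kvTau1 P'.j P'.hj P'.m) : P.j = P'.j := by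
  by_contra hne
  rcases Nat.lt_or_gt_of_ne hne with h | h
  · have ha : p - P'.j < p := by have := P'.hj; omega
    have t := congrFun e ⟨p - P'.j, ha⟩
    have h1 : ¬ (p - P.j ≤ p - P'.j) := by have := P'.hj; omega
    simp only [kvTau1, h1, dif_neg, not_false_eq_true, le_refl, dif_pos] at t
    have := P'.m_pos ⟨p - P'.j - (p - P'.j), by have := P'.hj; omega⟩
    omega
  · have ha : p - P.j < p := by have := P.hj; omega
    have t := congrFun e ⟨p - P.j, ha⟩
    have h1 : ¬ (p - P'.j ≤ p - P.j) := by have := P.hj; omega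
    simp only [kvTau1, h1, dif_neg, not_false_eq_true, le_refl, dif_pos] at t
    have := P.m_pos ⟨p - P.j - (p - P.j), by have := P.hj; omega⟩
    omega

/-- **Theorem (6.3 c) for the explicit parametrisation**: `τ(λ)` determines `λ` — "c) For any `k`,
the map `λ ↦ τ(λ)` is injective."  Proved here by computation on the integer vectors of (6.3 a)–b)
(KV prove it via the structure of pluriharmonic highest weight vectors, (6.1)–(6.2) p. 44).
[cite: KashiwaraVergne1978, III Thm (6.3) c) p. 44] -/
theorem lam_eq_of_tau_eq {P P' : KVParam k p q} (e : P.tau = P'.tau) : P.lam = P'.lam := by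
  have e1 : kvTau1 P.j P.hj P.m = kvTau1 P'.j P'.hj P'.m := congrArg Prod.fst e
  have e2 : kvTau2 P.i P.hi P.n = kvTau2 P'.i P'.hi P'.n := congrArg Prod.snd e
  have hi : P.i = P'.i := i_eq_of_tau2_eq e2
  have hj : P.j = P'.j := j_eq_of_tau1_eq e1
  have hiq := P.hi; have hjp := P.hj; have hijk := P.hij
  funext ν
  by_cases h : ν.val < P.i
  · have h' : ν.val < P'.i := hi ▸ h
    have t := congrFun e2 ⟨ν.val, lt_of_lt_of_le h P.hi⟩
    simp only [kvTau2, h, h', dif_pos] at t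
    simp only [KVParam.lam, kvLambda, h, h', dif_pos]
    exact t
  · have h' : ¬ ν.val < P'.i := hi ▸ h
    by_cases g : k - P.j ≤ ν.val
    · have g' : k - P'.j ≤ ν.val := hj ▸ g
      have hν : ν.val + p - k < p := by omega
      have t := congrFun e1 ⟨ν.val + p - k, hν⟩
      have c : p - P.j ≤ ν.val + p - k := by omega
      have c' : p - P'.j ≤ ν.val + p - k := by omega
      simp only [kvTau1, c, c', dif_pos] at t
      simp only [KVParam.lam, kvLambda, h, h', g, g', dif_pos, dif_neg, not_false_eq_true]
      have idx : (⟨ν.val + p - k - (p - P.j), by omega⟩ : Fin P.j) =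
          ⟨ν.val - (k - P.j), by omega⟩ := Fin.ext (by simp only; omega)
      have idx' : (⟨ν.val + p - k - (p - P'.j), by omega⟩ : Fin P'.j) =
          ⟨ν.val - (k - P'.j), by omega⟩ := Fin.ext (by simp only; omega)
      rw [idx, idx'] at t
      exact t
    · have g' : ¬ k - P'.j ≤ ν.val := hj ▸ g
      simp only [KVParam.lam, kvLambda, h, h', g, g', dif_neg, not_false_eq_true]

/-- Hence the highest weight `τ(λ) ⊗ δ_k` of `L_k(λ)` determines `λ`: distinct parameters give
non-isomorphic `L_k(λ)` ("Since `λ ↦ τ(λ)` is injective (6.3) we have (7.2) Theorem …").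
[cite: KashiwaraVergne1978, III (7.1)–(7.2) pp. 44–45] -/
theorem lam_eq_of_lowest_eq {P P' : KVParam k p q} (e : P.lowest = P'.lowest) : P.lam = P'.lam :=
  lam_eq_of_tau_eq (tau_eq_of_lowest_eq e)

/-- The parameters `(i, j, n, m)` themselves are determined by `λ` up to the proof fields:
`λ ↦ (i, j)` is read off the signs of the entries.  Here: `i` = the number of positive entries.
[cite: KashiwaraVergne1978, III Thm (6.3) a) p. 44] -/
theorem lam_pos_iff (ν : Fin k) : 0 < P.lam ν ↔ ν.val < P.i := by
  have hijk := P.hij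
  simp only [KVParam.lam, kvLambda]
  by_cases h : ν.val < P.i
  · simp only [h, dif_pos, iff_true]
    exact P.n_pos _
  · simp only [h, dif_neg, not_false_eq_true, iff_false, not_lt]
    by_cases g : k - P.j ≤ ν.val
    · simp only [g, dif_pos, Left.neg_nonpos_iff]
      exact (P.m_pos _).le
    · simp [g]

/-- … and the last `j` entries are exactly the negative ones.
[cite: KashiwaraVergne1978, III Thm (6.3) a) p. 44] -/
theorem lam_neg_iff (ν : Fin k) : P.lam ν < 0 ↔ k - P.j ≤ ν.val := by
  have hijk := P.hij
  simp only [KVParam.lam, kvLambda]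
  by_cases h : ν.val < P.i
  · simp only [h, dif_pos]
    have := P.n_pos ⟨ν.val, h⟩
    constructor
    · intro hlt; omega
    · intro hle; omega
  · simp only [h, dif_neg, not_false_eq_true]
    by_cases g : k - P.j ≤ ν.val
    · simp only [g, dif_pos, Left.neg_neg_iff, iff_true]
      exact P.m_pos _
    · simp [g]

/-! ## The worked line `(k; p, q) = (1; 2, 1)` -/

/-- For `k = 1`, `(p, q) = (2, 1)`: every `λ = (t)`, `t ∈ ℤ`, is a parameter of (6.3 a) (`t > 0`:
`i = 1, j = 0`; `t = 0`: `i = j = 0`; `t < 0`: `i = 0, j = 1`), and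
`τ(λ) ⊗ δ₁ = (0, min(t,0)) ⊗ (max(t,0) + 1)`; in particular every `U(1)`-type occurs in `L₁`
(`Σ = U(1)^`), in accordance with (8.1) p. 45 ("if `q ≤ k < p+q`, some of the representations
obtained are discrete, some are not"). [cite: KashiwaraVergne1978, III Thm (6.3) p. 44, (8.1) p. 45] -/
theorem exists_one_two_one (t : ℤ) :
    ∃ P : KVParam 1 2 1, P.lam = (fun _ => t) ∧ P.lowest = (![0, min t 0], ![max t 0 + 1]) := by
  rcases lt_trichotomy 0 t with ht | rfl | ht
  · refine ⟨⟨1, 0, le_rfl, by omega, by omega, fun _ => t, fun b => b.elim0, fun _ _ _ => le_rfl,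
      fun b => b.elim0, fun _ => ht, fun b => b.elim0⟩, ?_, ?_⟩
    · funext ν
      simp [KVParam.lam, kvLambda]
    · have h1 : min t 0 = 0 := min_eq_right ht.le
      have h2 : max t 0 = t := max_eq_left ht.le
      simp only [KVParam.lowest, h1, h2, Prod.mk.injEq]
      refine ⟨?_, ?_⟩
      · funext a
        fin_cases a <;> simp [kvTau1]
      · funext b
        fin_cases b
        simp [kvTau2]
  · refine ⟨⟨0, 0, by omega, by omega, by omega, fun a => a.elim0, fun b => b.elim0,
      fun a => a.elim0, fun b => b.elim0, fun a => a.elim0, fun b => b.elim0⟩, ?_, ?_⟩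
    · funext ν
      simp [KVParam.lam, kvLambda]
    · simp only [KVParam.lowest, min_self, max_self, zero_add, Prod.mk.injEq]
      refine ⟨?_, ?_⟩
      · funext a
        fin_cases a <;> simp [kvTau1]
      · funext b
        fin_cases b
        simp [kvTau2]
  · refine ⟨⟨0, 1, by omega, by omega, by omega, fun a => a.elim0, fun _ => -t, fun a => a.elim0,
      fun _ _ _ => le_rfl, fun a => a.elim0, fun _ => by omega⟩, ?_, ?_⟩
    · funext ν
      simp [KVParam.lam, kvLambda]
    · have h1 : min t 0 = t := min_eq_left ht.le
      have h2 : max t 0 = 0 := max_eq_right ht.le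
      simp only [KVParam.lowest, h1, h2, zero_add, Prod.mk.injEq]
      refine ⟨?_, ?_⟩
      · funext a
        fin_cases a <;> simp [kvTau1]
      · funext b
        fin_cases b
        simp [kvTau2]

end KVParam

end Literature.RepresentationTheory.KashiwaraVergne1978
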